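import Summits.ResolutionOfSingularities.ResolutionOfSingularities.Theses.Valuative
import Literature.AlgebraicGeometry.Resolution.GeneralLU

/-!
# Negative lemma for crux `PatchingRel` (stmt-ResolutionOfSingularities-0642): the crux is
# EQUIVALENT to its transcendence-degree-`≥ 4` / dimension-`≥ 4` slice

Load-bearing analysis (cdisprove gen 5, §10 (H11) of `Cruxes/PatchingRel/Disproof.lean`). The crux
is `∀ p prime, LUrel_p → ResolutionInChar p`. Modulo the named fact `CossartPiltant2019`
(Cossart–Piltant 2019, Thm. 1.1: weak resolution of reduced separated schemes of finite type of
dimension `≤ 3` over every field) BOTH ends are theorems up to dimension three: the antecedent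
`LUrel_p` holds for every function field of transcendence degree `≤ 3`
(`lurel_trdeg_le_three`: enlarge the prescribed `R` by an affine model of `K` inside `O`, then
`CossartPiltant2019.relLocalUniformization` = the valuative criterion applied to a resolution of
`Spec (R ⊔ A₀)`), and the consequent holds in dimension `≤ 3` verbatim
(`hasResolution_of_dim_le_three`). Hence `patchingRel_iff_highDim`: the crux is equivalent to
"relative LU for function fields of transcendence degree `≥ 4` ⇒ resolution of varieties of
dimension `≥ 4`" — the settled dimension range gives no leverage on the implication, on either
side (Piltant 2013, p. 1: "the Patching Theorem has never been extended to dimensions higher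
than three (without assuming beforehand the existence of nonsingular projective models)";
p. 2: "All of these problems are open in dimension four or more").
-/

set_option linter.dupNamespace false

namespace Summit.ResolutionOfSingularities.ResolutionOfSingularities.Theorems.PatchingRel.Negative

open Literature.AlgebraicGeometry.Resolution

/-- **The antecedent of the crux is free in transcendence degree `≤ 3`** (every ground field,
every characteristic), modulo `CossartPiltant2019`: every finitely generated `R ⊆ O` of a
function field `K/k` with `trdeg_k K ≤ 3` is dominated by a finitely generated `A ⊆ O` with
`Frac A = K`, regular at the centre of `O`. [cite: CossartPiltant2019, Thm. 1.1 with §4.1 (LU)] -/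
theorem lurel_trdeg_le_three (h : CossartPiltant2019.{0}) {k K : Type} [Field k] [Field K]
    [Algebra k K] (hKfg : (⊤ : IntermediateField k K).FG) (hK : Algebra.trdeg k K ≤ 3)
    (O : ValuationSubring K) (hO : ∀ c : k, algebraMap k K c ∈ O) (R : Subalgebra k K)
    (hRfg : R.FG) (hRO : R.toSubring ≤ O.toSubring) :
    ∃ (A : Subalgebra k K) (h : A.toSubring ≤ O.toSubring), R ≤ A ∧ A.FG ∧ IsFractionRing A K ∧
      IsRegularLocalRing (Localization.AtPrime
        (Ideal.comap (Subring.inclusion h) (IsLocalRing.maximalIdeal O))) := by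
  obtain ⟨A₀, hA₀O, hA₀fg, hA₀fr⟩ := exists_affineModel k K hKfg O hO
  have hR'O : (R ⊔ A₀).toSubring ≤ O.toSubring := by
    let Oalg : Subalgebra k K := { O.toSubring with algebraMap_mem' := hO }
    change R ⊔ A₀ ≤ Oalg
    exact sup_le (fun x hx => hRO hx) (fun x hx => hA₀O hx)
  have hR'fr : IsFractionRing ↥(R ⊔ A₀) K := isFractionRing_of_le le_sup_right hA₀fr
  obtain ⟨A, hA, hle, hAfg, hreg⟩ :=
    h.relLocalUniformization k K hK O (R ⊔ A₀) (hRfg.sup hA₀fg) hR'fr hR'O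
  exact ⟨A, hA, le_sup_left.trans hle, hAfg, isFractionRing_of_le hle hR'fr, hreg⟩

/-- Modulo `CossartPiltant2019`, the high-transcendence-degree antecedent is equivalent to the
full antecedent `LUrel_p` of the crux. [folklore] -/
theorem lurelTrdegGe4_iff (h : CossartPiltant2019.{0}) (p : ℕ) :
    (∀ (k K : Type) [Field k] [CharP k p] [Field K] [Algebra k K], (⊤ : IntermediateField k K).FG →
        ¬ Algebra.trdeg k K ≤ 3 →
        ∀ O : ValuationSubring K, (∀ c : k, algebraMap k K c ∈ O) → ∀ R : Subalgebra k K, R.FG →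
          R.toSubring ≤ O.toSubring → ∃ (A : Subalgebra k K) (h : A.toSubring ≤ O.toSubring),
            R ≤ A ∧ A.FG ∧ IsFractionRing A K ∧ IsRegularLocalRing (Localization.AtPrime
              (Ideal.comap (Subring.inclusion h) (IsLocalRing.maximalIdeal O)))) ↔
      ∀ (k K : Type) [Field k] [CharP k p] [Field K] [Algebra k K],
        (⊤ : IntermediateField k K).FG → ∀ O : ValuationSubring K,
          (∀ c : k, algebraMap k K c ∈ O) → ∀ R : Subalgebra k K, R.FG →
            R.toSubring ≤ O.toSubring → ∃ (A : Subalgebra k K) (h : A.toSubring ≤ O.toSubring),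
              R ≤ A ∧ A.FG ∧ IsFractionRing A K ∧ IsRegularLocalRing (Localization.AtPrime
                (Ideal.comap (Subring.inclusion h) (IsLocalRing.maximalIdeal O))) := by
  refine ⟨fun H k K _ _ _ _ hKfg O hO R hRfg hRO => ?_,
    fun H k K _ _ _ _ hKfg _ O hO R hRfg hRO => H k K hKfg O hO R hRfg hRO⟩
  by_cases hK : Algebra.trdeg k K ≤ 3
  · exact lurel_trdeg_le_three h hKfg hK O hO R hRfg hRO
  · exact H k K hKfg hK O hO R hRfg hRO

/-- Modulo `CossartPiltant2019`, resolution in dimension `≥ 4` is equivalent to resolution in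
characteristic `p` (dimension `≤ 3` is the named fact, `hasResolution_of_dim_le_three`).
[cite: CossartPiltant2019, Thm. 1.1] -/
theorem resDimGe4_iff (h : CossartPiltant2019.{0}) (p : ℕ) :
    (∀ (k : Type) [Field k] [CharP k p] (X : AlgebraicGeometry.Scheme.{0})
        (f : X ⟶ AlgebraicGeometry.Spec (.of k)), AlgebraicGeometry.IsSeparated f →
          AlgebraicGeometry.LocallyOfFiniteType f → AlgebraicGeometry.QuasiCompact f →
            AlgebraicGeometry.IsReduced X → ¬ topologicalKrullDim X ≤ 3 → Scheme.HasResolution X) ↔ ResolutionInChar.{0} p := by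
  refine ⟨fun H k _ _ X f hsep hft hqc hred => ?_,
    fun H k _ _ X f hsep hft hqc hred _ => H k X f hsep hft hqc hred⟩
  by_cases hd : topologicalKrullDim X ≤ 3
  · haveI := hsep; haveI := hft; haveI := hqc; haveI := hred
    exact hasResolution_of_dim_le_three h k X f hd
  · exact H k X f hsep hft hqc hred hd

/-- **The crux `PatchingRel` is its high-dimensional slice** (modulo `CossartPiltant2019`):
`PatchingRel ↔ ∀ p prime, (LUrel_p in trdeg ≥ 4) → (Res_p in dim ≥ 4)`. A refutation therefore needs relative
local uniformization for some function field of transcendence degree `≥ 4` feeding a variety of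
dimension `≥ 4` without resolution; a proof gains nothing from the dimension-`≤ 3` theorems.
[folklore] -/
theorem patchingRel_iff_highDim (h : CossartPiltant2019.{0}) :
    Theses.Valuative.PatchingRel ↔ ∀ p : ℕ, p.Prime →
      (∀ (k K : Type) [Field k] [CharP k p] [Field K] [Algebra k K], (⊤ : IntermediateField k K).FG →
        ¬ Algebra.trdeg k K ≤ 3 →
        ∀ O : ValuationSubring K, (∀ c : k, algebraMap k K c ∈ O) → ∀ R : Subalgebra k K, R.FG →
          R.toSubring ≤ O.toSubring → ∃ (A : Subalgebra k K) (h : A.toSubring ≤ O.toSubring),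
            R ≤ A ∧ A.FG ∧ IsFractionRing A K ∧ IsRegularLocalRing (Localization.AtPrime
              (Ideal.comap (Subring.inclusion h) (IsLocalRing.maximalIdeal O)))) →
      (∀ (k : Type) [Field k] [CharP k p] (X : AlgebraicGeometry.Scheme.{0})
        (f : X ⟶ AlgebraicGeometry.Spec (.of k)), AlgebraicGeometry.IsSeparated f →
          AlgebraicGeometry.LocallyOfFiniteType f → AlgebraicGeometry.QuasiCompact f →
            AlgebraicGeometry.IsReduced X → ¬ topologicalKrullDim X ≤ 3 → Scheme.HasResolution X) :=
  ⟨fun H p hp hLU => (resDimGe4_iff h p).mpr (H p hp ((lurelTrdegGe4_iff h p).mp hLU)),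
    fun H p hp hLU => (resDimGe4_iff h p).mp (H p hp ((lurelTrdegGe4_iff h p).mpr hLU))⟩

end Summit.ResolutionOfSingularities.ResolutionOfSingularities.Theorems.PatchingRel.Negative
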